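import Summits.NavierStokesRegularity.NavierStokesRegularity.Theses.AxisymmetricExtremality
import Summits.NavierStokesRegularity.NavierStokesRegularity.Theorems.AxisymmetricExtremalityPFoldToAxisymmetricCompactModuloSim
import Literature.Analysis.FluidPDE.RusinSverakCompactnessHolds
import Literature.Analysis.FluidPDE.RusinSverakMinimalData
import Literature.Analysis.FluidPDE.HomSobolevRepresentedL3

/-!
# Route AxisymmetricExtremality — crux `MinimalDatumPFold` (stmt-NavierStokesRegularity-15452), stub `stub_concentrationNearMinimalLimit`

Registered stub of the line `Sketch` (`Cruxes/MinimalDatumPFold/Lines/Sketch.lean`, lead c2).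
Target tree file:
`Summits/NavierStokesRegularity/NavierStokesRegularity/Theorems/AxisymmetricExtremalityMinimalDatumPFoldConcentrationNearMinimalLimit.lean`.

**Sub-threshold concentrating sequences have minimal `L³`-limits modulo `Sim`.** This is the
analogue of the tree's `stub_nearMinimalLimit`
(`AxisymmetricExtremalityMinimalDatumPFoldNearMinimalLimit.lean`) with the weak-limit blow-up leaf
`rusin_sverak_weak_limit_blowup_holds` replaced by its CONCENTRATION analogue, taken verbatim as
the first hypothesis (it is the statement of the landed stub `stub_concentrationWeakLimitBlowup`
of the same line, minus that stub's own hypothesis). For `ν > 0` with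
`ρ := rusinSverakRhoMaxPure ν < ⊤`: admissible data `(U k, G k)` (`U k ∈ L³`, `G k` represents
`complexify ∘ U k`, weakly divergence free) which are SUB-threshold (`‖G k‖ₑ < ρ`) and whose
Kato-class mild solutions `u k` on `[0, 1)` concentrate at `(1, x k)` admit scales `lam j > 0`,
centres `x₀ j`, a subsequence `φ` and a MINIMAL blow-up datum `(v, g)`
(`IsMinimalBlowupDatum ν v g`) with `rescaleData (lam j) (U (φ j) (· - x₀ j)) → v` in `L³(ℝ³)`.

Proof (Rusin–Šverák 2011, proof of Cor. 4.3, p. 8, run for a sub-threshold concentrating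
sequence):

1. `‖G k‖ ≤ ρ.toReal` from `‖G k‖ₑ < ρ < ⊤`.
2. The hypothesis (concentration weak-limit blow-up) gives the modulation `lam k, x₀ k`; the
   modulated data are represented by classes `g' k` of the same norms
   (`exists_represents_rescaleData_norm_eq`).
3. A subsequence `g' (φ n)` converges weakly (`exists_strictMono_tendsto_inner`, `Ḣ^{1/2}` is
   separable: `homSobolev_half_secondCountableTopology`) to `glim`, which by the hypothesis
   represents a datum `v₀` WITHOUT a global Kato solution; hence `ρ ≤ ‖glim‖ₑ`
   (`hasGlobalKatoSolution_of_lt_rusinSverakRhoMaxPure`), while `‖glim‖ ≤ ρ.toReal` by weak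
   lower semicontinuity (`norm_le_of_tendsto_inner_of_norm_le`): `(v₀, glim) ∈ M`.
4. `‖g' (φ n)‖ ≤ ρ.toReal = ‖glim‖`, so Radon–Riesz with only an UPPER bound on the norms
   (`concentrationNearMinimal_tendsto_of_tendsto_inner_of_norm_le`,
   `0 ≤ ‖x n - a‖² = ‖x n‖² - 2 Re ⟪x n, a⟫ + ‖a‖² ≤ 2‖a‖² - 2 Re ⟪x n, a⟫ → 0`) gives
   `g' (φ n) → glim` in `Ḣ^{1/2}`.
5. `‖v_j - v₀‖_{L³} ≤ C ‖g' (φ j) - glim‖ → 0` (`eLpNorm_three_sub_le_of_represents`,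
   Bahouri–Chemin–Danchin 2011 Thm. 1.38 via `exists_const_eLpNorm_three_le_of_represents_complexify`).

References: W. Rusin, V. Šverák, J. Funct. Anal. 260 (2011) 879–891 = arXiv:0911.0500, Cor. 4.3 and
its proof (p. 8) [RusinSverak2011]; H. Bahouri, J.-Y. Chemin, R. Danchin, *Fourier Analysis and
Nonlinear PDE* (2011), Thm. 1.38 [BahouriCheminDanchin2011].
-/

set_option linter.dupNamespace false

noncomputable section

open MeasureTheory Set Function Filter Topology
open scoped ENNReal NNReal InnerProductSpace

namespace Summit.NavierStokesRegularity.NavierStokesRegularity.Theorems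

/-- **Radon–Riesz property of Hilbert spaces, with only an upper bound on the norms**: if
`x n → a` weakly (`⟪x n, w⟫ → ⟪a, w⟫` for all `w`) and `‖x n‖ ≤ ‖a‖` for all `n`, then `x n → a`
in norm, since `0 ≤ ‖x n - a‖² = ‖x n‖² - 2 Re ⟪x n, a⟫ + ‖a‖² ≤ 2‖a‖² - 2 Re ⟪x n, a⟫ → 0`.
(The tree's `Literature.Analysis.FluidPDE.tendsto_of_tendsto_inner_of_norm_eq` is the
constant-norm case.) [folklore] -/
theorem concentrationNearMinimal_tendsto_of_tendsto_inner_of_norm_le {H : Type*}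
    [NormedAddCommGroup H] [InnerProductSpace ℂ H] {x : ℕ → H} {a : H}
    (hw : ∀ w : H, Tendsto (fun n => ⟪x n, w⟫_ℂ) atTop (𝓝 ⟪a, w⟫_ℂ))
    (hn : ∀ n, ‖x n‖ ≤ ‖a‖) : Tendsto x atTop (𝓝 a) := by
  have hre : Tendsto (fun n => RCLike.re ⟪x n, a⟫_ℂ) atTop (𝓝 (‖a‖ ^ 2)) := by
    have h1 : Tendsto (fun n => RCLike.re ⟪x n, a⟫_ℂ) atTop (𝓝 (RCLike.re ⟪a, a⟫_ℂ)) :=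
      (RCLike.continuous_re.tendsto _).comp (hw a)
    have h2 : RCLike.re ⟪a, a⟫_ℂ = ‖a‖ ^ 2 := by
      rw [inner_self_eq_norm_sq_to_K]; norm_cast
    rwa [h2] at h1
  have hsq : Tendsto (fun n => ‖x n - a‖ ^ 2) atTop (𝓝 0) := by
    have hup : Tendsto (fun n => 2 * ‖a‖ ^ 2 - 2 * RCLike.re ⟪x n, a⟫_ℂ) atTop (𝓝 0) := by
      have h : Tendsto (fun n => 2 * ‖a‖ ^ 2 - 2 * RCLike.re ⟪x n, a⟫_ℂ) atTop
          (𝓝 (2 * ‖a‖ ^ 2 - 2 * ‖a‖ ^ 2)) := (hre.const_mul 2).const_sub _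
      simpa using h
    refine tendsto_of_tendsto_of_tendsto_of_le_of_le tendsto_const_nhds hup
      (fun n => sq_nonneg _) (fun n => ?_)
    have h2 : ‖x n - a‖ ^ 2 = ‖x n‖ ^ 2 - 2 * RCLike.re ⟪x n, a⟫_ℂ + ‖a‖ ^ 2 :=
      @norm_sub_sq ℂ _ _ _ _ (x n) a
    have h3 : ‖x n‖ ^ 2 ≤ ‖a‖ ^ 2 := pow_le_pow_left₀ (norm_nonneg _) (hn n) 2
    rw [h2]
    linarith
  rw [tendsto_iff_norm_sub_tendsto_zero]
  have h := hsq.sqrt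
  simpa [Real.sqrt_sq (norm_nonneg _)] using h

/-- **Sub-threshold concentrating sequences have minimal `L³`-limits modulo `Sim`** (registered
stub `stub_concentrationNearMinimalLimit` of the line `Sketch`, crux `MinimalDatumPFold`). GIVEN
the concentration weak-limit blow-up statement (first hypothesis; the statement of the landed stub
`stub_concentrationWeakLimitBlowup`): for `ν > 0` with `ρ_max^pure(ν) < ⊤`, admissible data
`(U k, G k)` — `U k ∈ L³`, `G k ∈ Ḣ^{1/2}` representing `complexify ∘ U k`, weakly divergence
free — with `‖G k‖ₑ < ρ_max^pure(ν)`, whose Kato-class mild solutions `u k` on `[0, 1)`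
concentrate at `(1, x k)` (the essential suprema of `|u k|` on every backward cylinder
`Q_r(1, x k)` tend to `∞`), admit scales `lam j > 0`, centres `x₀ j`, a subsequence `φ` and a
MINIMAL blow-up datum `(v, g)` (`IsMinimalBlowupDatum ν v g`) with
`y ↦ lam j • U (φ j) (lam j • y - x₀ j)` converging to `v` in `L³`. Proof sketch: the hypothesis
modulates; the modulated classes (`exists_represents_rescaleData_norm_eq`, same norms `≤ ρ.toReal`)
have a weakly convergent subsequence (`exists_strictMono_tendsto_inner`) whose limit `glim`
represents a datum `v` without a global Kato solution, so `ρ ≤ ‖glim‖ₑ`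
(`hasGlobalKatoSolution_of_lt_rusinSverakRhoMaxPure`) and `‖glim‖ ≤ ρ.toReal` (weak l.s.c.,
`norm_le_of_tendsto_inner_of_norm_le`): `(v, glim) ∈ M`; as `‖g' (φ n)‖ ≤ ‖glim‖`, Radon–Riesz
with an upper bound (`concentrationNearMinimal_tendsto_of_tendsto_inner_of_norm_le`) gives strong
`Ḣ^{1/2}` convergence, and `eLpNorm_three_sub_le_of_represents` (BCD 2011 Thm. 1.38) the `L³`
convergence. [cite: RusinSverak2011, Cor. 4.3 and its proof (arXiv:0911.0500 p. 8)] -/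
theorem stub_concentrationNearMinimalLimit :
    (∀ ν : ℝ, 0 < ν → ∀ (U : ℕ → EuclideanSpace ℝ (Fin 3) → EuclideanSpace ℝ (Fin 3)) (G : ℕ → Literature.Analysis.FunctionSpaces.HomSobolev (EuclideanSpace ℝ (Fin 3)) (EuclideanSpace ℂ (Fin 3)) (1 / 2 : ℝ)) (u : ℕ → ℝ → EuclideanSpace ℝ (Fin 3) → EuclideanSpace ℝ (Fin 3)) (x : ℕ → EuclideanSpace ℝ (Fin 3)), (∀ k, MeasureTheory.MemLp (U k) 3 (MeasureTheory.volume : MeasureTheory.Measure (EuclideanSpace ℝ (Fin 3))) ∧ (G k).Represents (Literature.Analysis.FunctionSpaces.EuclideanSpace.complexify ∘ U k) ∧ Literature.Analysis.FluidPDE.IsWeaklyDivFree (U k)) → (∃ R : ℝ, ∀ k, ‖G k‖ ≤ R) → (∀ k, Literature.Analysis.FluidPDE.IsMildNSSolutionOn (Set.Ico 0 1) ν 0 (U k) (u k) ∧ Literature.Analysis.FluidPDE.ContinuousInLpOn (Set.Ico 0 1) 3 (u k) ∧ u k 0 = U k ∧ MeasureTheory.AEStronglyMeasurable (Function.uncurry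 (u k)) (MeasureTheory.volume.restrict (Set.Ioo (0 : ℝ) 1 ×ˢ (Set.univ : Set (EuclideanSpace ℝ (Fin 3)))))) → (∀ r : ℝ, 0 < r → Filter.Tendsto (fun k => MeasureTheory.eLpNorm (Function.uncurry (u k)) ⊤ (MeasureTheory.volume.restrict (Literature.Analysis.FluidPDE.parabolicCylinder r ((1 : ℝ), x k)))) Filter.atTop (nhds ⊤)) → ∃ (lam : ℕ → ℝ) (x₀ : ℕ → EuclideanSpace ℝ (Fin 3)), (∀ k, 0 < lam k) ∧ ∀ g' : ℕ → Literature.Analysis.FunctionSpaces.HomSobolev (EuclideanSpace ℝ (Fin 3)) (EuclideanSpace ℂ (Fin 3)) (1 / 2 : ℝ), (∀ k, (g' k).Represents (Literature.Analysis.FunctionSpaces.EuclideanSpace.complexify ∘ Literature.Analysis.FluidPDE.rescaleData (lam k) (fun y => U k (y - x₀ k)))) → ∀ φ : ℕ → ℕ, StrictMono φ → ∀ glim : Literature.Analysis.FunctionSpaces.HomSobolev (EuclideanSpace ℝ (Fin 3)) (EuclideanSpace ℂ (Fin 3)) (1 / 2 : ℝ), (∀ w, Filter.Tendsto (fun n =>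 inner ℂ (g' (φ n)) w) Filter.atTop (nhds (inner ℂ glim w))) → ∃ v₀ : EuclideanSpace ℝ (Fin 3) → EuclideanSpace ℝ (Fin 3), MeasureTheory.MemLp v₀ 3 (MeasureTheory.volume : MeasureTheory.Measure (EuclideanSpace ℝ (Fin 3))) ∧ glim.Represents (Literature.Analysis.FunctionSpaces.EuclideanSpace.complexify ∘ v₀) ∧ Literature.Analysis.FluidPDE.IsWeaklyDivFree v₀ ∧ ¬ Literature.Analysis.FluidPDE.HasGlobalKatoSolution ν v₀) →
    ∀ ν : ℝ, 0 < ν → Literature.Analysis.FluidPDE.rusinSverakRhoMaxPure ν < ⊤ → ∀ (U : ℕ → EuclideanSpace ℝ (Fin 3) → EuclideanSpace ℝ (Fin 3)) (G : ℕ → Literature.Analysis.FunctionSpaces.HomSobolev (EuclideanSpace ℝ (Fin 3)) (EuclideanSpace ℂ (Fin 3)) (1 / 2 : ℝ)) (u : ℕ → ℝ → EuclideanSpace ℝ (Fin 3) → EuclideanSpace ℝ (Fin 3)) (x : ℕ → EuclideanSpace ℝ (Fin 3)), (∀ k, MeasureTheory.MemLp (U k) 3 (MeasureTheory.volume : MeasureTheory.Measure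 (EuclideanSpace ℝ (Fin 3))) ∧ (G k).Represents (Literature.Analysis.FunctionSpaces.EuclideanSpace.complexify ∘ U k) ∧ Literature.Analysis.FluidPDE.IsWeaklyDivFree (U k) ∧ ‖G k‖ₑ < Literature.Analysis.FluidPDE.rusinSverakRhoMaxPure ν) → (∀ k, Literature.Analysis.FluidPDE.IsMildNSSolutionOn (Set.Ico 0 1) ν 0 (U k) (u k) ∧ Literature.Analysis.FluidPDE.ContinuousInLpOn (Set.Ico 0 1) 3 (u k) ∧ u k 0 = U k ∧ MeasureTheory.AEStronglyMeasurable (Function.uncurry (u k)) (MeasureTheory.volume.restrict (Set.Ioo (0 : ℝ) 1 ×ˢ (Set.univ : Set (EuclideanSpace ℝ (Fin 3)))))) → (∀ r : ℝ, 0 < r → Filter.Tendsto (fun k => MeasureTheory.eLpNorm (Function.uncurry (u k)) ⊤ (MeasureTheory.volume.restrict (Literature.Analysis.FluidPDE.parabolicCylinder r ((1 : ℝ), x k)))) Filter.atTop (nhds ⊤)) → ∃ (lam : ℕ → ℝ) (x₀ : ℕ → EuclideanSpace ℝ (Fin 3)) (φ : ℕ → ℕ) (v : EuclideanSpace ℝ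 (Fin 3) → EuclideanSpace ℝ (Fin 3)) (g : Literature.Analysis.FunctionSpaces.HomSobolev (EuclideanSpace ℝ (Fin 3)) (EuclideanSpace ℂ (Fin 3)) (1 / 2 : ℝ)), (∀ j, 0 < lam j) ∧ StrictMono φ ∧ Literature.Analysis.FluidPDE.IsMinimalBlowupDatum ν v g ∧ Filter.Tendsto (fun j => MeasureTheory.eLpNorm (Literature.Analysis.FluidPDE.rescaleData (lam j) (fun y => U (φ j) (y - x₀ j)) - v) 3 (MeasureTheory.volume : MeasureTheory.Measure (EuclideanSpace ℝ (Fin 3)))) Filter.atTop (nhds 0) := by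
  intro hWL ν hν hfin U G u x hU hkato hconc
  set ρ := Literature.Analysis.FluidPDE.rusinSverakRhoMaxPure ν with hρ
  have hρtop : ρ ≠ ⊤ := hfin.ne
  -- (1) norm bound: `‖G k‖ ≤ ρ.toReal` from `‖G k‖ₑ < ρ < ⊤`
  have hnorm_le : ∀ k, ‖G k‖ ≤ ρ.toReal := fun k => by
    have h := ENNReal.toReal_mono hρtop (hU k).2.2.2.le
    rwa [toReal_enorm] at h
  -- (2) modulation by the concentration weak-limit blow-up hypothesis
  obtain ⟨lam, x₀, hlam, hlim⟩ :=
    hWL ν hν U G u x (fun k => ⟨(hU k).1, (hU k).2.1, (hU k).2.2.1⟩) ⟨ρ.toReal, hnorm_le⟩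
      hkato hconc
  -- (3) classes of the modulated data, of the same norms
  choose g' hg'rep hg'norm using fun k =>
    Literature.Analysis.FluidPDE.exists_represents_rescaleData_norm_eq (U k) (G k) (hlam k) (x₀ k)
      (hU k).2.1
  -- (4) a weakly convergent subsequence
  haveI : SecondCountableTopology (Literature.Analysis.FunctionSpaces.HomSobolev
      (EuclideanSpace ℝ (Fin 3)) (EuclideanSpace ℂ (Fin 3)) (1 / 2 : ℝ)) :=
    Literature.Analysis.FluidPDE.homSobolev_half_secondCountableTopology
  obtain ⟨glim, φ, hφ, -, hweak⟩ :=
    Literature.Analysis.FluidPDE.exists_strictMono_tendsto_inner g' (R := ρ.toReal)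
      fun n => by rw [hg'norm]; exact hnorm_le n
  -- (5) the weak limit represents a minimal blow-up datum
  obtain ⟨v₀, hv3, hvrep, hvdiv, hvblow⟩ := hlim g' hg'rep φ hφ glim hweak
  have hge : ρ ≤ ‖glim‖ₑ := by
    by_contra h
    push Not at h
    exact hvblow
      (Literature.Analysis.FluidPDE.hasGlobalKatoSolution_of_lt_rusinSverakRhoMaxPure hv3 hvrep
        hvdiv h)
  have hle : ‖glim‖ ≤ ρ.toReal :=
    Literature.Analysis.FluidPDE.norm_le_of_tendsto_inner_of_norm_le hweak tendsto_const_nhds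
      (fun n => by rw [hg'norm]; exact hnorm_le (φ n))
  have hnormlim : ‖glim‖ = ρ.toReal := by
    refine le_antisymm hle ?_
    have h := ENNReal.toReal_mono (enorm_ne_top (x := glim)) hge
    rwa [toReal_enorm] at h
  have henorm : ‖glim‖ₑ = ρ := by
    rw [← ofReal_norm, hnormlim, ENNReal.ofReal_toReal hρtop]
  have hmin : Literature.Analysis.FluidPDE.IsMinimalBlowupDatum ν v₀ glim :=
    ⟨hv3, hvrep, hvdiv, henorm, hvblow⟩
  -- (6) `‖g' (φ n)‖ ≤ ‖glim‖`, hence strong `Ḣ^{1/2}` convergence (Radon–Riesz, upper bound)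
  have htend : Tendsto (fun n => g' (φ n)) atTop (𝓝 glim) :=
    concentrationNearMinimal_tendsto_of_tendsto_inner_of_norm_le hweak fun n => by
      rw [hg'norm, hnormlim]; exact hnorm_le (φ n)
  -- (7) `L³` convergence of the modulated data along `φ`
  refine ⟨fun j => lam (φ j), fun j => x₀ (φ j), φ, v₀, glim, fun j => hlam (φ j), hφ, hmin, ?_⟩
  obtain ⟨C, hC⟩ :=
    Literature.Analysis.FluidPDE.exists_const_eLpNorm_three_le_of_represents_complexify
  have hbd : ∀ j, eLpNorm
      (Literature.Analysis.FluidPDE.rescaleData (lam (φ j)) (fun y => U (φ j) (y - x₀ (φ j))) - v₀)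
        3 volume ≤ C * ‖g' (φ j) - glim‖ₑ := fun j =>
    PFoldToAxisymmetric.CompactModuloSim.eLpNorm_three_sub_le_of_represents hC (hg'rep (φ j))
      hvrep
  have hclass : Tendsto (fun j => ‖g' (φ j) - glim‖ₑ) atTop (𝓝 0) := by
    have h := (htend.sub_const glim).enorm
    simpa only [sub_self, enorm_zero] using h
  have hmul : Tendsto (fun j => (C : ℝ≥0∞) * ‖g' (φ j) - glim‖ₑ) atTop (𝓝 0) := by
    simpa only [mul_zero] using ENNReal.Tendsto.const_mul hclass (Or.inr ENNReal.coe_ne_top)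
  exact tendsto_of_tendsto_of_tendsto_of_le_of_le tendsto_const_nhds hmul (fun _ => bot_le) hbd

end Summit.NavierStokesRegularity.NavierStokesRegularity.Theorems

end
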